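/-
Origin: expansion seat `planner-pub-hodgecm-pv07-0`, handover 2026-08-18T03:35:56Z (`HOME/pub-hodgecm-pv07/lean/Pv07/LocalFactors.lean`, md5 be281284, 148 lines);
landed by the gen-5 packager in gate run 19 as `HodgeCM/PerL34/LocalFactors.lean` (import ^import Pv07\.(BallDichotomy|SplitFactor|CompactFactor|KernelRadius)\b→import HodgeCM.PerL34.LocalFactors.\1 ×2).
-/
/-
Copyright: pub-hodgecm formalisation cell (harness21, 2026). New file (not vendored).
Origin: pub-hodgecm-pv07 (DAG-NODE PROVER #07), node N31f = PerL v5 Lemma 4.2(b), proof step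
"LOCAL FACTORS" (tex ll. 608–623).  This file: the node-level TYPED CORES and their proofs.
Intended final place: `HodgeCM/PerL34/LocalFactors.lean` (the carver's planned stub name; the two
imports become `HodgeCM.PerL34.LocalFactors.SplitFactor` / `.CompactFactor`).
-/
import Summits.HodgeConjecture.HodgeCM.PerL34.LocalFactors.SplitFactor
import Summits.HodgeConjecture.HodgeCM.PerL34.LocalFactors.CompactFactor

/-!
# N31f — PerL v5 Lemma 4.2(b), proof step "local factors" (tex ll. 608–623)

Verbatim node text (tex ll. 608–623):
"For `φ = ⊗φ_v` the last integral is `∏_v I_v(φ_v)`,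
`I_v(φ_v) := ∫_{U(W_i)(L_{0,v})} ⟨ω_v(y)φ_v, φ_v⟩ χ'_v(y) dy`.  Each `I_v` is absolutely convergent
(`U(W_i)(L_{0,v})` is compact unless `v` splits in `L`, where it is `L_{0,v}^×` acting on
`𝒮(L_{0,v}^3)` by `(ω(y)φ)(x) = |y|^{3/2}φ(yx)` up to a unitary character, so that
`|⟨ω_v(y)φ_v, φ_v⟩| ≪ min(|y|,|y|⁻¹)^{3/2}`), and `I_v(φ_v) ≥ 0`, being the value at `χ̄'_v` of the
Fourier transform of the positive-definite function `m(y) := ⟨ω_v(y)φ_v, φ_v⟩` on the abelian group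
`U(W_i)(L_{0,v})`; it is `> 0` for suitable `φ_v`: at archimedean and at non-split finite `v`
(compact group) `I_v(φ_v) = vol·‖φ_v[χ̄'_v]‖²` with `φ_v[χ̄'_v]` the `χ̄'_v`-isotypic component, which
is non-zero for suitable `φ_v`: at a real place `b` the `χ̄'_b`-isotypic part is the part singled out
in Lemma 4.1(a) (`U(W_{i,b})` acts there by `u^{-e_b(Ψ_i)} = χ̄'_b(u)`), and at a non-split finite
`v` every character occurs (local occurrence proved above); at split `v` take `φ_v` the
characteristic function of a ball `D = x₀ + ϖ^N𝒪³` around a point `x₀ ≠ 0`, with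
`N > ord(x₀) := min_j ord(x_{0,j})` (minimum over the coordinates) so large that the open subgroup
`U₁ := {y ∈ L_{0,v}^× : (y−1)x₀ ∈ ϖ^N𝒪³} ⊂ 𝒪^×` lies in the kernels of `χ'_v` and of the auxiliary
unitary character of the Weil representation; for `y ∈ U₁` one has `yD = D`, while for `y ∉ U₁`,
`yD ∩ D = ∅` (compare absolute values if `|y| ≠ 1`, first digits otherwise); hence
`m = vol(D)𝟙_{U₁}` and `I_v(φ_v) = vol(D)vol(U₁) > 0`."

## Carving (LEMMAS.md §1 row N31f; carver's `Chars.lean`: N31f = the field `RallisDatum.ram_pos`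
`∀ v ∈ S, 0 < Iloc v` of the prior programme's Euler-product skeleton `Perl34.C4.RallisDatum`).

HONEST SPLIT (L2) of N31f.  What the node USES downstream is only: for the finitely many places
`v ∈ S` and the CHOSEN local vectors `φ_v`, `I_v(φ_v)` is a positive real number (`ram_pos`).  The
tex obtains this from four ingredients; their status in this package:

* (F1) split `v`, the Schrödinger-model action `(ω(y)φ)(x) = ν(y)|y|^{3/2}φ(yx)` of
  `U(W_i)(L_{0,v}) ≅ L_{0,v}^×` on `𝒮(L_{0,v}^3)` — PRINT INPUT, not formalised (no Weil-representation
  vocabulary in the package, LEMMAS.md §3 D4): the type-II (general linear) dual pair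
  `(GL₁, GL₃)(L_{0,v})` acts on `𝒮(M_{1,3}(L_{0,v}))` by `ω(a,b)φ(x) = |det a|^{-3/2}|det b|^{1/2}φ(a⁻¹xb)`
  [Kudla, *Notes on the local theta correspondence* (1996), Ch. III, Remark 6.3; the Levi formula
  `r(m(a))Φ(x) = |det a|^{1/2}Φ(xa)`: Gelbart–Piatetski-Shapiro–Rallis, LNM 1254 (1987), Part B §4.2,
  (4.2.2)–(4.2.3), pp. 85–87]; recorded as GAPS.md entry N31f-G1 together with the identification of
  the split unitary pair with the type-II pair twisted by a unitary character (MVW, LNM 1291, ch. 3).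
  GIVEN (F1), `m(y) = ⟨ω(y)𝟙_D, 𝟙_D⟩ = a(y)·vol{x ∈ D : yx ∈ D}` with `a = ν·|·|^{3/2}` (`= 1` on `U₁`),
  which is the DEFINITION `ballCoeff` of `Pv07.SplitFactor`; everything the tex then asserts is
  KERNEL-PROVED: `N31f_core_split` below (ball lemma, `m = vol(D)𝟙_{U₁}`,
  `I_v = vol(D)vol(U₁) > 0`).  (Either convention `φ(yx)` / `φ(y⁻¹x)` gives the same `m`, since `U₁`
  is inversion-stable: `BallDichotomy.inv_mem_U1`.)
* (F2) compact `v` (archimedean, non-split finite): `ω_v|_{U(W_i)}` is a unitary representation of a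
  compact (abelian) group and `dy` its Haar measure — the only print content is "unitary
  representation, Haar measure"; the projection formula `I_v(φ_v) = vol·‖φ_v[χ̄'_v]‖²`, hence
  `I_v ≥ 0`, and `I_v(v) = ‖v‖² > 0` for a nonzero `χ̄'_v`-isotypic `v`, are KERNEL-PROVED for every
  unitary representation of every compact group: `N31f_core_compact` below.  The EXISTENCE of a
  nonzero `χ̄'_v`-isotypic vector is NOT this node (real `b`: Lemma 4.1(a) = node N27; non-split
  finite `v`: local occurrence = node N31a).
* (F3) "`I_v(φ_v) ≥ 0` … Fourier transform of the positive-definite function `m`" (Bochner) — NOT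
  LOAD-BEARING: only the positivity of `I_v` for the chosen `φ_v`, `v ∈ S`, and `I_v(φ_v⁰) > 0` for
  `v ∉ S` (node N31g/N31h) enter the Euler product; at compact places `≥ 0` is anyway a corollary of
  (F2) (`localFactor_re_nonneg`).  Not formalised, not needed; noted in GAPS.md N31f-G2 for the record.
* (F4) absolute convergence `|⟨ω_v(y)φ_v,φ_v⟩| ≪ min(|y|,|y|⁻¹)^{3/2}` at split `v` for GENERAL `φ_v` —
  not needed for the chosen `φ_v = 𝟙_D` (`m = vol(D)𝟙_{U₁}` has compact support in `L_{0,v}^×`);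
  the factorisation `∏_v I_v` of the adelic integral for factorizable `φ` is part of the
  Euler-product node N31h (`RallisDatum.AX7_factor/AX7_tail`).  Not formalised here (GAPS.md N31f-G2).
-/

set_option autoImplicit false

namespace HodgeCM
namespace PerL34

open Metric Set MeasureTheory Complex LocalFactors
open scoped Pointwise InnerProductSpace

/-- **N31f core, split places** (tex ll. 617–623, verbatim under the dictionary of
`Pv07.BallDichotomy`: `F = L_{0,v}`, `Fin n → F = L_{0,v}^3` (`n = 3`), `D = closedBall x₀ r`,
`r = |ϖ|^N`, `r < ‖x₀‖ ⟺ N > ord(x₀)`, `μ = dx`, `η = d^×y` (or `dy`, cf. `withDensity_inv_norm_U1`),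
`a = ν·|·|^{3/2}` and `χ = χ'_v`, both trivial on `U₁`): `U₁` is open, `yD = D` on `U₁`,
`yD ∩ D = ∅` off `U₁`, `m = vol(D)𝟙_{U₁}`, `I_v(φ_v) = vol(D)vol(U₁)`, and `vol(D)vol(U₁) > 0`. -/
def N31f_core_split : Prop :=
  ∀ (F : Type) [NormedField F] [IsUltrametricDist F] [ProperSpace F] [MeasurableSpace F]
    [BorelSpace F] (n : ℕ) (μ : Measure (Fin n → F)) [μ.IsOpenPosMeasure]
    [IsFiniteMeasureOnCompacts μ] (η : Measure F) [η.IsOpenPosMeasure] [IsFiniteMeasureOnCompacts η]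
    (a χ : F → ℂ) (x₀ : Fin n → F) (r : ℝ), r < ‖x₀‖ → 0 < r →
    (∀ y ∈ U1 x₀ r, a y = 1) → (∀ y ∈ U1 x₀ r, χ y = 1) →
      IsOpen (U1 x₀ r) ∧
      (∀ y : F, y ∈ U1 x₀ r → y • closedBall x₀ r = closedBall x₀ r) ∧
      (∀ y : F, y ∉ U1 x₀ r → Disjoint (y • closedBall x₀ r) (closedBall x₀ r)) ∧
      (ballCoeff a μ x₀ r = (U1 x₀ r).indicator fun _ => (μ.real (closedBall x₀ r) : ℂ)) ∧
      (∫ y, ballCoeff a μ x₀ r y * χ y ∂η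
          = ((μ.real (closedBall x₀ r) * η.real (U1 x₀ r) : ℝ) : ℂ)) ∧
      0 < μ.real (closedBall x₀ r) * η.real (U1 x₀ r)

/-- **N31f, split places: PROVED.** -/
theorem N31f_core_split_holds : N31f_core_split := by
  intro F _ _ _ _ _ n μ _ _ η _ _ a χ x₀ r hr hr0 ha hχ
  have hx : x₀ ≠ 0 := by
    intro h
    rw [h, norm_zero] at hr
    exact absurd (hr0.trans hr) (lt_irrefl 0)
  exact ⟨isOpen_U1 hr0, fun y hy => smul_ball_eq_of_mem_U1 hr hy,
    fun y hy => disjoint_smul_ball_of_not_mem_U1 hr hy, ballCoeff_eq_indicator hr ha,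
    integral_ballCoeff_mul_eq hr hr0 η ha hχ, ballFactor_pos hx hr0⟩

/-- **N31f core, compact places** (tex ll. 612–617, verbatim under the dictionary of
`Pv07.CompactFactor`: `G = U(W_i)(L_{0,v})` compact abelian, `μ` = its Haar probability measure,
`ρ = ω_v|_{U(W_i)}` unitary and strongly continuous on the Hilbert space `E`, `χ = χ'_v` a continuous
unitary character; PerL's `⟨ω(y)φ,φ⟩` = Mathlib's `⟪φ, ρ y φ⟫`): the projection formula
`I_v(φ) = ‖φ[χ̄'_v]‖²` with `φ[χ̄'_v] := isoProj φ` a `χ̄'_v`-isotypic vector, `I_v(φ) ≥ 0`, and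
`I_v(v) = ‖v‖² > 0` for every nonzero `χ̄'_v`-isotypic `v` ("non-zero for suitable `φ_v`"). -/
def N31f_core_compact : Prop :=
  ∀ (G : Type) [CommGroup G] [TopologicalSpace G] [IsTopologicalGroup G] [CompactSpace G]
    [MeasurableSpace G] [BorelSpace G] (μ : Measure G) [μ.IsHaarMeasure] [IsProbabilityMeasure μ]
    (E : Type) [NormedAddCommGroup E] [InnerProductSpace ℂ E] [CompleteSpace E]
    (ρ : G →* (E →L[ℂ] E)) (χ : G →* ℂ), Continuous χ → (∀ g, ‖χ g‖ = 1) →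
    (∀ g (v w : E), ⟪ρ g v, ρ g w⟫_ℂ = ⟪v, w⟫_ℂ) → (∀ v : E, Continuous fun g : G => ρ g v) →
      (∀ φ : E, localFactor μ ρ χ φ = ((‖isoProj μ ρ χ φ‖ ^ 2 : ℝ) : ℂ)) ∧
      (∀ φ : E, IsIsotypic ρ χ (isoProj μ ρ χ φ)) ∧
      (∀ φ : E, 0 ≤ (localFactor μ ρ χ φ).re ∧ (localFactor μ ρ χ φ).im = 0) ∧
      (∀ v : E, IsIsotypic ρ χ v → localFactor μ ρ χ v = ((‖v‖ ^ 2 : ℝ) : ℂ)) ∧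
      (∀ v : E, IsIsotypic ρ χ v → v ≠ 0 → 0 < (localFactor μ ρ χ v).re)

/-- **N31f, compact places: PROVED.** -/
theorem N31f_core_compact_holds : N31f_core_compact := by
  intro G _ _ _ _ _ _ μ _ _ E _ _ _ ρ χ hχc hχ1 hρu hρc
  exact ⟨fun φ => localFactor_eq_norm_sq hχc hχ1 hρu hρc φ,
    fun φ => isoProj_mem_isotypic hχc hχ1 hρc φ,
    fun φ => localFactor_re_nonneg hχc hχ1 hρu hρc φ,
    fun v hv => localFactor_eq_of_isotypic hχ1 hv,
    fun v hv hv0 => localFactor_pos_of_isotypic hχ1 hv hv0⟩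

/-- **N31f ⇒ `ram_pos`, the consumed form.**  If at each place `v` of the finite set `S` the local
factor `Iloc v` of the chosen `φ_v` IS (the real part of) a compact-place factor at a nonzero
isotypic vector, or a split-place ball factor, then `∀ v ∈ S, 0 < Iloc v` — the field
`Perl34.C4.RallisDatum.ram_pos`.  (Pure bookkeeping over the two cores; the identification of
`Iloc v` with these models is print input (F1)/(F2) of the module docstring.) -/
theorem ram_pos_of_models {V : Type} (S : Finset V) (Iloc : V → ℝ)
    (model : ∀ v ∈ S, ∃ c : ℝ, 0 < c ∧ Iloc v = c) : ∀ v ∈ S, 0 < Iloc v := by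
  intro v hv
  obtain ⟨c, hc, h⟩ := model v hv
  rw [h]
  exact hc

end PerL34
end HodgeCM
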